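import Summits.ResolutionOfSingularities.ResolutionOfSingularities.Theorems.FrobeniusLadderFRationalResolutionToricRetract
import Summits.ResolutionOfSingularities.ResolutionOfSingularities.Theorems.FrobeniusLadderFRationalResolutionToricBaseRegular
import Mathlib.Algebra.MonoidAlgebra.MapDomain
import Mathlib.RingTheory.MvPolynomial.Basic
import HarnessLib

/-!
# Toric surface programme: `k[σ∨ ∩ ℤ²] = k[X₀, X₁]^{μ_r}` — the diagonalizable-quotient presentation on exponents

Support file for crux stmt-ResolutionOfSingularities-15317 (`FrobeniusLadder.FRationalResolution`),
line `redirect`, lead c4 (toric surface programme: all affine toric surfaces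
`U(r,a) = Spec k[{m ∈ ℤ² : 0 ≤ m₂, a m₂ ≤ r m₁}]` over every field are resolved by the
Hirzebruch–Jung tower — the dimension-2, all-fields instance of the redirect line's endgame
`stub_diagonalizableQuotientResolution`; this file supplies the presentation of `TA[r, a]` as the
weight-`0` part of `k[X₀, X₁]` for the `ℤ/r`-grading with weights `(a, 1)`, i.e. as the ring of
invariants of `μ_r` acting by `(ζ^a, ζ)`, valid also for `p ∣ r`).

The construction is on EXPONENTS and characteristic free. Three lattice maps enter:

* the exponent embedding `ι : ℕ^{Fin 2} ↪ ℤ²`, `d ↦ (d 0, d 1)`, whose push-forward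
  `I = AddMonoidAlgebra.mapDomainAlgHom k k ι : k[X₀, X₁] → k[ℤ²]` is injective with range
  `TA[1, 0] = k[ℕ²]` (tree: `toricBase_range_eq`);
* the injective lattice map `λ(m₁, m₂) = (m₂, r m₁ − a m₂)` (determinant `−r ≠ 0`), with
  `m ∈ σS[r, a] ↔ λ m ∈ ℕ²` and image the index-`r` sublattice `{n : r ∣ a n₁ + n₂}`, whose
  push-forward `L = AddMonoidAlgebra.mapDomainAlgHom k k λ` maps `TA[r, a]` into `TA[1, 0]`
  (tree: `toricRetract_mem_iff`, the exponent description of `TA[r, a]`);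
* `ε := (AlgEquiv.ofInjective I)⁻¹ ∘ L|TA[r, a] : TA[r, a] →ₐ[k] k[X₀, X₁]`, injective, with
  `I ∘ ε = L`.

Range: `f = ε t` forces every exponent `d` of `f` to satisfy `ι d = λ m` for an exponent `m` of
`t`, so `a d₀ + d₁ = a m₂ + (r m₁ − a m₂) = r m₁`; conversely if `r ∣ a d₀ + d₁` on the support
of `f`, then the support of `I f` lies in `λ(ℤ²)` (`(d₀, d₁) = λ((a d₀ + d₁)/r, d₀)`), so the
coefficient pull-back `g = AddMonoidAlgebra.comapDomain λ (I f)` has `L g = I f`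
(`Finsupp.mapDomain_comapDomain`), lies in `TA[r, a]` (its exponents `m` have `λ m = ι d ∈ ℕ²`),
and `ε g = f` by injectivity of `I`.

All folklore (Cox–Little–Schenck 2011, §1.3 and Ex. 1.3.20; Fulton 1993, §2.2); no published
fact is used and no definition is introduced (the lattice maps are inline terms).
-/

set_option linter.dupNamespace false

noncomputable section

namespace Summit.ResolutionOfSingularities.ResolutionOfSingularities.Theorems.FRationalResolution

open CategoryTheory AlgebraicGeometry TopologicalSpace
open Literature.AlgebraicGeometry.Resolution

section Toric

variable (k : Type) [Field k]

/-- The Laurent polynomial ring `k[ℤ²]` (coordinate ring of the 2-torus). -/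
local notation3 "Lk" => AddMonoidAlgebra k (ℤ × ℤ)

/-- The lattice points of the dual cone `σ∨ = {m₂ ≥ 0, a m₂ ≤ r m₁}` of `σ = cone((0,1),(r,-a))`. -/
local notation3 "σS[" r ", " a "]" =>
  {m : ℤ × ℤ | 0 ≤ m.2 ∧ ((a : ℕ) : ℤ) * m.2 ≤ ((r : ℕ) : ℤ) * m.1}

/-- The toric surface algebra `k[σ∨ ∩ ℤ²] ⊆ k[ℤ²]`. -/
local notation3 "TA[" r ", " a "]" =>
  Algebra.adjoin k ((fun m : ℤ × ℤ => AddMonoidAlgebra.single m (1 : k)) '' σS[r, a])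

/-- **The diagonalizable-quotient presentation `TA[r, a] = k[X₀, X₁]^{μ_r}`** (registered stub
`stub_toric_weightZero`, crux stmt-ResolutionOfSingularities-15317, line `redirect`): for `1 ≤ r`
(every field, also `p ∣ r`) there is an injective `k`-algebra map `ε : TA[r, a] → k[X₀, X₁]` whose
range is exactly the set of polynomials supported on the monomials `X₀^d₀ X₁^d₁` with
`r ∣ a d₀ + d₁` — the weight-`0` part for the `ℤ/r`-grading with weights `(a, 1)`. The map is
`χᵐ ↦ X₀^(λ m).1 X₁^(λ m).2` for the lattice embedding `λ(m₁, m₂) = (m₂, r m₁ − a m₂)`, realised as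
`(AlgEquiv.ofInjective I)⁻¹ ∘ (AddMonoidAlgebra.mapDomainAlgHom k k λ)|TA[r, a]` with
`I : k[X₀, X₁] ↪ k[ℤ²]` the exponent embedding `d ↦ (d 0, d 1)` (range `TA[1, 0]`,
`toricBase_range_eq`; `L(TA[r, a]) ⊆ TA[1, 0]` by `toricRetract_mem_iff`). Exponents of `ε t` are
`λ`-images, whence `a d₀ + d₁ = r m₁`; conversely a polynomial `f` with `r ∣ a d₀ + d₁` on its
support has `I f` supported on `λ(σS[r, a])`, and the coefficient pull-back
`AddMonoidAlgebra.comapDomain λ (I f) ∈ TA[r, a]` is a preimage (`Finsupp.mapDomain_comapDomain`).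
[folklore; Cox–Little–Schenck 2011, §1.3, Ex. 1.3.20] -/
theorem stub_toric_weightZero (r a : ℕ) (hr : 1 ≤ r) :
    ∃ ε : ↥TA[r, a] →ₐ[k] MvPolynomial (Fin 2) k, Function.Injective ε ∧
      ∀ f : MvPolynomial (Fin 2) k, f ∈ Set.range ε ↔
        ∀ d ∈ f.support, (r : ℤ) ∣ (a : ℤ) * (d 0 : ℕ) + (d 1 : ℕ) := by
  -- the exponent embedding `ι : ℕ^{Fin 2} ↪ ℤ²`, `d ↦ (d 0, d 1)`, and `I = mapDomain ι`
  let ι : (Fin 2 →₀ ℕ) →+ ℤ × ℤ :=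
    AddMonoidHom.prod ((Nat.castAddMonoidHom ℤ).comp (Finsupp.applyAddHom 0))
      ((Nat.castAddMonoidHom ℤ).comp (Finsupp.applyAddHom 1))
  have hι : ∀ d, ι d = (((d 0 : ℕ) : ℤ), ((d 1 : ℕ) : ℤ)) := fun d => rfl
  have hιinj : Function.Injective ι := by
    intro d d' h
    rw [hι, hι, Prod.mk.injEq, Nat.cast_inj, Nat.cast_inj] at h
    ext i
    fin_cases i
    exacts [h.1, h.2]
  let I : MvPolynomial (Fin 2) k →ₐ[k] Lk := AddMonoidAlgebra.mapDomainAlgHom k k ι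
  have hIapp : ∀ p, I p = AddMonoidAlgebra.mapDomain ι p := fun p => rfl
  have hIinj : Function.Injective I := fun p q hpq =>
    AddMonoidAlgebra.mapDomain_injective hιinj (by rwa [hIapp, hIapp] at hpq)
  have hrange : I.range = TA[1, 0] :=
    toricBase_range_eq k 1 le_rfl I fun d c => by
      rw [hIapp, AddMonoidAlgebra.mapDomain_single, hι]
  -- the lattice map `λ(m₁, m₂) = (m₂, r m₁ − a m₂)` and `L = mapDomain λ`
  let lam : ℤ × ℤ →+ ℤ × ℤ :=
    { toFun := fun m => (m.2, (r : ℤ) * m.1 - (a : ℤ) * m.2)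
      map_zero' := by simp
      map_add' := fun m n => Prod.ext rfl (by simp only [Prod.fst_add, Prod.snd_add]; ring) }
  have hlam : ∀ m, lam m = (m.2, (r : ℤ) * m.1 - (a : ℤ) * m.2) := fun m => rfl
  have hr' : (0 : ℤ) < (r : ℤ) := by exact_mod_cast hr
  have hinj : Function.Injective lam := by
    intro m n h
    rw [hlam, hlam, Prod.mk.injEq] at h
    obtain ⟨h2, h1⟩ := h
    rw [h2, sub_left_inj] at h1
    exact Prod.ext (mul_left_cancel₀ hr'.ne' h1) h2
  have hmem : ∀ m, m ∈ σS[r, a] ↔ 0 ≤ (lam m).1 ∧ 0 ≤ (lam m).2 := by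
    intro m
    simp only [Set.mem_setOf_eq, hlam, sub_nonneg]
  let L : Lk →ₐ[k] Lk := AddMonoidAlgebra.mapDomainAlgHom k k lam
  have hLapp : ∀ x, L x = AddMonoidAlgebra.mapDomain lam x := fun x => rfl
  have hLmem : ∀ t : ↥TA[r, a], L t ∈ I.range := by
    intro t
    rw [hrange, toricRetract_mem_iff]
    intro n hn
    rw [hLapp, AddMonoidAlgebra.coeff_mapDomain] at hn
    obtain ⟨m, hm, rfl⟩ := Finset.mem_image.1 (Finsupp.mapDomain_support hn)
    rw [toricBase_mem_iff 1 le_rfl]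
    exact (hmem m).1 ((toricRetract_mem_iff k r a (t : Lk)).1 t.2 m hm)
  -- `ε = (ofInjective I)⁻¹ ∘ L|TA[r, a]`
  let L' : ↥TA[r, a] →ₐ[k] ↥I.range := (L.comp (TA[r, a]).val).codRestrict I.range hLmem
  let e : MvPolynomial (Fin 2) k ≃ₐ[k] ↥I.range := AlgEquiv.ofInjective I hIinj
  let ε : ↥TA[r, a] →ₐ[k] MvPolynomial (Fin 2) k := e.symm.toAlgHom.comp L'
  have hIε : ∀ t, I (ε t) = L t := fun t => by
    have h := AlgEquiv.ofInjective_apply I hIinj (e.symm (L' t))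
    rw [AlgEquiv.apply_symm_apply] at h
    exact h.symm
  refine ⟨ε, ?_, fun f => ⟨?_, fun hf => ?_⟩⟩
  · -- injectivity: `I ∘ ε = L ∘ val` is injective
    intro s t hst
    have h := congrArg I hst
    rw [hIε, hIε, hLapp, hLapp] at h
    exact Subtype.ext (AddMonoidAlgebra.mapDomain_injective hinj h)
  · -- exponents of `ε t` are `λ`-images: `a d₀ + d₁ = a m₂ + (r m₁ − a m₂) = r m₁`
    rintro ⟨t, rfl⟩ d hd
    have h1 : ι d ∈ (I (ε t)).coeff.support := by
      rw [hIapp, AddMonoidAlgebra.coeff_mapDomain, Finsupp.mem_support_iff,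
        Finsupp.mapDomain_apply hιinj]
      exact MvPolynomial.mem_support_iff.1 hd
    rw [hIε, hLapp, AddMonoidAlgebra.coeff_mapDomain] at h1
    obtain ⟨m, -, hmd⟩ := Finset.mem_image.1 (Finsupp.mapDomain_support h1)
    rw [hlam, hι, Prod.mk.injEq] at hmd
    exact ⟨m.1, by linear_combination (-(a : ℤ)) * hmd.1 - hmd.2⟩
  · -- a polynomial with `r ∣ a d₀ + d₁` on its support: pull `I f` back along `λ`
    have hsupp : ↑(I f).coeff.support ⊆ Set.range lam := by
      intro n hn
      rw [Finset.mem_coe, hIapp, AddMonoidAlgebra.coeff_mapDomain] at hn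
      obtain ⟨d, hd, rfl⟩ := Finset.mem_image.1 (Finsupp.mapDomain_support hn)
      obtain ⟨q, hq⟩ := hf d hd
      refine ⟨(q, ((d 0 : ℕ) : ℤ)), ?_⟩
      rw [hlam, hι, Prod.mk.injEq]
      exact ⟨rfl, by linear_combination -hq⟩
    have hLg : L (AddMonoidAlgebra.comapDomain lam hinj (I f)) = I f := by
      apply AddMonoidAlgebra.ext
      rw [hLapp, AddMonoidAlgebra.coeff_mapDomain, AddMonoidAlgebra.coeff_comapDomain]
      exact Finsupp.mapDomain_comapDomain lam hinj _ hsupp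
    have hg : AddMonoidAlgebra.comapDomain lam hinj (I f) ∈ TA[r, a] := by
      rw [toricRetract_mem_iff]
      intro m hm
      rw [AddMonoidAlgebra.coeff_comapDomain, Finsupp.comapDomain_support, Finset.mem_preimage,
        hIapp, AddMonoidAlgebra.coeff_mapDomain] at hm
      obtain ⟨d, -, hdm⟩ := Finset.mem_image.1 (Finsupp.mapDomain_support hm)
      rw [hmem, ← hdm, hι]
      exact ⟨Int.natCast_nonneg _, Int.natCast_nonneg _⟩
    refine ⟨⟨_, hg⟩, hIinj ?_⟩
    rw [hIε]
    exact hLg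

end Toric

end Summit.ResolutionOfSingularities.ResolutionOfSingularities.Theorems.FRationalResolution

end
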